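import Summits.ResolutionOfSingularities.ResolutionOfSingularities.Theorems.WeightedInvariantTerminatingCentreDatumConsumer
import Summits.ResolutionOfSingularities.ResolutionOfSingularities.Theorems.WeightedInvariantWeightedThesisHypersurfaceChoiceTower
import Summits.ResolutionOfSingularities.ResolutionOfSingularities.Theorems.WeightedInvariantWeightedThesisHypersurfaceTowerRegular
import HarnessLib

/-!
# Every hypersurface terminating centre datum IS a hypersurface centre choice (door H1c) — second consumer path

Route `ResolutionOfSingularities/WeightedInvariant`, crux `Theses.WeightedInvariant.HypersurfaceCentreConstruction`
(stmt-ResolutionOfSingularities-19897), door line `local-engine`, CRUX-PLAN r1 of `res-L1-w43-plan-1`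
(sketch `L/res-L1-w43-plan-1/door_globalize_sketch.lean`, sha16 `4548141fdf78465f`): helper **H1c —
the CONVERSE of the packaging H1** (`Theorems/…HypersurfaceCentreChoiceToDatum.lean`).  A
`HypersurfaceTerminatingCentreDatum p` (`Theorems/…TerminatingCentreDatum.lean`: rating `inv` with `(ii)`,
centre with `(iii-a)` regular weighted centre, `(iii-b′)` support under the non-minimal locus of `inv`,
`(hom)` homogeneity on graded affine charts, and a well-ordered rank with `(term)`) IS a
`HypersurfaceCentreChoice p` (`Theorems/…HypersurfaceChoice.lean`) with the SAME centre:

* `(iii)` and `(H)` are the datum's `(iii-a)` / `(hom)`, the guard "∃ y, inv not minimal" coming from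
  non-regularity by `(ii)` (`HypersurfaceTerminatingCentreDatum.exists_not_isBot_inv_of_not_isRegular`);
* `(ii′)` (generic point off the centre): by `(ii)` the rating is minimal over the generic point of the
  integral hypersurface — its local ring, the function field, is regular — while the centre lies in the
  non-minimal locus by `(iii-b′)` (the tree's `HypersurfaceTerminatingCentreDatum.genericPoint_not_mem_support_centre`,
  here `…_of_not_isRegular`);
* `(T)`: a tower step strictly lowers the rank by `(term)`, so `HypersurfacePair.Step centre` is a
  subrelation of the inverse image of `<` on the well-ordered `Λ` (`wellFounded_step`).

Consequences: the sketch's target `nonempty_choice_of_hypersurfaceTerminatingCentreDatum` (signature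
verbatim), and the SECOND, INDEPENDENT CONSUMER PATH for the door datum announced in the sketch —
`weightedThesis_of_hypersurfaceTerminatingCentreDatum_viaChoice`: hypersurface terminating centre data at
every prime + prime-wise Bergh–Rydh ⇒ `WeightedThesis`, through RESHAPE 9's choice tower
`weightedThesis_of_hypersurfaceChoice_of_forall_berghRydh_charP` (the route's consumer of record,
`Theorems/…TerminatingCentreDatumConsumer.lean`, runs the relaxed-interface tower instead).
Nothing here is a claim about Hironaka's problem; no `Nonempty` of anything is asserted unconditionally.
-/

noncomputable section

open CategoryTheory AlgebraicGeometry TopologicalSpace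
open Literature.AlgebraicGeometry.Resolution

set_option linter.dupNamespace false -- mandated namespace of this single-conjunct summit

namespace Summit.ResolutionOfSingularities.ResolutionOfSingularities.Theorems

namespace HypersurfaceTerminatingCentreDatum

variable {p : ℕ} (E : HypersurfaceTerminatingCentreDatum p)

section Guard

variable {k : Type} [Field k] [CharP k p] [PerfectField k] {Y : Scheme.{0}}
  (f : Y ⟶ Spec (.of k)) [Smooth f] [IsSeparated f] [QuasiCompact f]

/-- **The guard from non-regularity** (`(ii)` contraposed): on a hypersurface pair whose hypersurface
is not regular the rating is somewhere non-minimal. [folklore] -/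
theorem exists_not_isBot_inv_of_not_isRegular (X : Y.IdealSheafData) (hX : IsLocallyPrincipal X)
    (hXi : IsIntegral X.subscheme) (hsing : ¬ Scheme.IsRegular X.subscheme) :
    ∃ y : Y, ¬ IsBot (E.inv f X y) := by
  by_contra hcon
  push Not at hcon
  exact hsing ((E.forall_isBot_inv_iff f X hX hXi).mp hcon)

variable {X : Scheme.{0}} (i : X ⟶ Y) [IsClosedImmersion i]

/-- **`(ii′)` for the datum, from non-regularity** — the generic point of the integral, non-regular
hypersurface `X` is off the centre: the tree's `genericPoint_not_mem_support_centre`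
(`Theorems/…TerminatingCentreDatumConsumer.lean`: the function field is a regular local ring, so the
rating is minimal there by `(ii)`, while the centre lies in the non-minimal locus by `(iii-b′)`), with
its guard supplied by `exists_not_isBot_inv_of_not_isRegular`. [folklore] -/
theorem genericPoint_not_mem_support_centre_of_not_isRegular [IsIntegral X]
    (hX : IsLocallyPrincipal i.ker) (hsing : ¬ Scheme.IsRegular X) :
    i (genericPoint X) ∉ (E.centre f i.ker).support :=
  have hXi : IsIntegral i.ker.subscheme := HypersurfaceTower.isIntegral_ker_subscheme i
  E.genericPoint_not_mem_support_centre f i hX hXi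
    (E.exists_not_isBot_inv_of_not_isRegular f i.ker hX hXi
      fun h => hsing ((isRegular_iff_isRegular_image i).mpr h))

end Guard

/-- **`(T)` for the datum — the cobordant tower of its centre stops**: a tower step strictly lowers the
rank (`(term)`), so `HypersurfacePair.Step centre` is well-founded over every perfect field of
characteristic `p` (subrelation of the inverse image of `<` on the well-ordered `Λ`). [folklore] -/
theorem wellFounded_step {k : Type} [Field k] [CharP k p] [PerfectField k] :
    WellFounded (HypersurfacePair.Step (k := k) fun ⦃Y : Scheme.{0}⦄ (f : Y ⟶ Spec (.of k)) X =>
      E.centre f X) := by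
  refine Subrelation.wf (r := InvImage (· < ·) fun P : HypersurfacePair k => E.rank P.f P.X) ?_
    (InvImage.wf _ wellFounded_lt)
  intro P' P h
  obtain ⟨hsing, R', hR', hs, hsep, hqc, hlp, hint, rfl⟩ := h
  exact E.rank_lt P.f P.X P.isLocallyPrincipal P.isIntegral
    (E.exists_not_isBot_inv_of_not_isRegular P.f P.X P.isLocallyPrincipal P.isIntegral hsing) R' hR'

/-- **H1c — every hypersurface terminating centre datum is a hypersurface centre choice** (keep the
centre; `(iii)`/`(H)` = `(iii-a)`/`(hom)` under the guard from `(ii)`; `(ii′)` =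
`genericPoint_not_mem_support_centre_of_not_isRegular`; `(T)` = `wellFounded_step`). [folklore] -/
def toChoice : HypersurfaceCentreChoice p where
  centre := E.centre
  isRegularWeightedCentre_centre := fun _ _ _ _ _ f _ _ _ X hX hXi hsing =>
    E.isRegularWeightedCentre_centre f X hX hXi
      (E.exists_not_isBot_inv_of_not_isRegular f X hX hXi hsing)
  genericPoint_not_mem_support_centre := fun _ _ _ _ _ _ f _ _ _ i _ _ hX hsing =>
    E.genericPoint_not_mem_support_centre_of_not_isRegular f i hX hsing
  centre_isHomogeneous := fun _ _ _ _ _ f _ _ _ X hX hXi hsing _ W 𝒢 _ h0 hXhom n =>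
    E.centre_isHomogeneous f X hX hXi (E.exists_not_isBot_inv_of_not_isRegular f X hX hXi hsing)
      _ W 𝒢 h0 hXhom n
  wellFounded_step := fun _ _ _ _ => E.wellFounded_step

/-- `toChoice` keeps the centre. [folklore] -/
@[simp] theorem toChoice_centre : E.toChoice.centre = E.centre := rfl

end HypersurfaceTerminatingCentreDatum

/-- **H1c (the sketch's target, signature verbatim): every hypersurface terminating centre datum in
characteristic `p` yields a hypersurface centre choice in characteristic `p`.**  Witness:
`HypersurfaceTerminatingCentreDatum.toChoice` (same centre). [folklore] -/
theorem nonempty_choice_of_hypersurfaceTerminatingCentreDatum (p : ℕ)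
    (E : HypersurfaceTerminatingCentreDatum p) : Nonempty (HypersurfaceCentreChoice p) :=
  ⟨E.toChoice⟩

/-- **Second, independent consumer path for the door datum** (the cross-check announced in the
sketch): hypersurface terminating centre data at every prime (the door `HypersurfaceCentreConstruction`,
prime by prime) and prime-wise resolution of finite diagonalizable quotient singularities étale-locally
(Bergh–Rydh shape) give `WeightedThesis` — through H1c and RESHAPE 9's choice tower
`weightedThesis_of_hypersurfaceChoice_of_forall_berghRydh_charP`, NOT through the relaxed-interface
tower of `Theorems/…TerminatingCentreDatumConsumer.lean`. [folklore] -/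
theorem weightedThesis_of_hypersurfaceTerminatingCentreDatum_viaChoice :
    (∀ p : ℕ, p.Prime → Nonempty (HypersurfaceTerminatingCentreDatum p)) →
    (∀ p : ℕ, p.Prime → ∀ (k : Type) [Field k] [CharP k p] [PerfectField k] (V : Scheme.{0})
      (g : V ⟶ Spec (.of k)) [IsIntegral V] [IsSeparated g] [LocallyOfFiniteType g] [QuasiCompact g],
      (∀ v : V, ∃ (A : Type) (_ : AddCommGroup A) (_ : Finite A) (_ : DecidableEq A)
        (S : Type) (_ : CommRing S) (_ : Algebra k S) (𝒮 : A → Submodule k S)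
        (_ : GradedAlgebra 𝒮), Algebra.FiniteType k S ∧ Algebra.Smooth k S ∧
        ∃ φ : Spec (.of (𝒮 0)) ⟶ V, Etale φ ∧ v ∈ Set.range φ ∧
          φ ≫ g = Spec.map (CommRingCat.ofHom (algebraMap k (𝒮 0)))) →
      Scheme.HasResolution V) →
    Summit.ResolutionOfSingularities.ResolutionOfSingularities.Theses.WeightedInvariant.WeightedThesis :=
  fun hE => weightedThesis_of_hypersurfaceChoice_of_forall_berghRydh_charP
    fun p hp => (hE p hp).map HypersurfaceTerminatingCentreDatum.toChoice

end Summit.ResolutionOfSingularities.ResolutionOfSingularities.Theorems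

end
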